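import Literature.Computation.Certificates.GramSOS
import Mathlib.Analysis.Calculus.Deriv.Pow
import Mathlib.Analysis.Calculus.Deriv.Mul
import Mathlib.Analysis.Calculus.Deriv.Add
import Mathlib.Algebra.BigOperators.Group.Finset.Basic
import HarnessLib

/-!
# Lie derivatives of sparse rational polynomials along polynomial vector fields (chain rule)

Compute-infrastructure extension of `Certificates/SumOfSquares.lean` (same discipline: computable
`List`-based data, soundness proved once). For the sparse polynomials `SOS.Poly` of that file this
module provides

* `SOS.Monomial.expAt`, `SOS.Monomial.dec` — exponent lookup / decrement at a variable index;
* `SOS.Poly.pderiv k p` — the partial derivative `∂p/∂x_k` (computable, coefficientwise);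
* `SOS.Poly.numVars p` — a bound on the variable indices occurring in `p`;
* `SOS.Poly.lieDeriv F V` — the LIE DERIVATIVE `Σ_k (∂_k V) · F_k` of `V` along the polynomial
  vector field `F : List Poly` (component `k` = `F[k]`, missing components read as `0`), as a
  `Poly` computed in the kernel — so a Lyapunov certificate can state `V̇` as `lieDeriv F V`
  instead of shipping `V̇` as unverified data;
* the CHAIN RULE `SOS.Poly.hasDerivWithinAt_eval_lieDeriv`: if a curve `z : ℝ → (ℕ → ℝ)` has
  coordinate derivatives `d z_k/dt = F_k(z(t))` within `s` at `t` for every `k`, then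
  `t ↦ V(z(t))` has derivative `(lieDeriv F V)(z(t))` within `s` at `t` (and the general form
  `hasDerivWithinAt_eval` with arbitrary coordinate derivatives `g k`).

This is the calculus half of the bridge from kernel-checked polynomial inequalities
(`SOS.Poly.nonneg_of_checkG` applied to `-lieDeriv F V - …`) to statements about solutions of
`ż = F(z)` (sublevel-set invariance, `Literature/Analysis/ODE/LyapunovSublevelInvariance.lean`);
first consumer: venture GRIDFUSION (`Summits/Ventures/GridStability/`), whose recast swing models
supply exactly the hypothesis `∀ k, HasDerivWithinAt (fun τ => z τ k) ((F.getD k []).eval (z t)) s t`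
(`Models.SMIB.hasDerivWithinAt_embed`, `Models.RecastData.hasDerivWithinAt_embed`).

References: N. Rouche, P. Habets, M. Laloy, *Stability Theory by Liapunov's Direct Method* (Springer
1977), Ch. I §3.1 eq. (3.1): for `C¹` `V` and a solution `x(t)` of `ẋ = f(t,x)`, `V*(t) = V(t, x(t))` has
derivative `V̇(t, x(t))` with `V̇ = (∂V/∂x | f) + ∂V/∂t` [corpus: book:rouchend-stability-theory-by-liapunov-s-direct-method p0033]
— formalised here for autonomous polynomial `f` and polynomial `V`; data format of
Blekherman–Parrilo–Thomas 2012 §3.1 as in `SumOfSquares.lean`.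

## Not here

No `MvPolynomial` bridge; no simplification of `lieDeriv`'s output beyond `Poly.norm` (apply
`Poly.collect`/`norm` downstream if a canonical form is wanted — `eval` is invariant).
-/

namespace Literature.Computation.Certificates

namespace SOS

open Finset

/-! ### Exponent bookkeeping on monomials -/

namespace Monomial

/-- Exponent of the `j`-th variable (counted from the start of the exponent vector); `0` beyond the
end. [folklore] -/
def expAt : Monomial → ℕ → ℕ
  | [], _ => 0
  | e :: _, 0 => e
  | _ :: es, j + 1 => expAt es j

/-- Decrement the `j`-th exponent (truncated subtraction; the vector is unchanged beyond its end).
[folklore] -/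
def dec : ℕ → Monomial → Monomial
  | _, [] => []
  | 0, e :: es => (e - 1) :: es
  | j + 1, e :: es => e :: dec j es

/-- `expAt` vanishes beyond the length of the exponent vector. [folklore] -/
private theorem expAt_eq_zero_of_le : ∀ (m : Monomial) (j : ℕ), m.length ≤ j → expAt m j = 0
  | [], _, _ => rfl
  | _ :: _, 0, h => by simp at h
  | _ :: es, j + 1, h => expAt_eq_zero_of_le es j (by simpa using h)

/-- `expAt [] j = 0`. [folklore] -/
@[simp] private theorem expAt_nil (j : ℕ) : expAt [] j = 0 := rfl
/-- `expAt` at the head. [folklore] -/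
@[simp] private theorem expAt_cons_zero (e : ℕ) (es : Monomial) : expAt (e :: es) 0 = e := rfl
/-- `expAt` in the tail. [folklore] -/
@[simp] private theorem expAt_cons_succ (e : ℕ) (es : Monomial) (j : ℕ) :
    expAt (e :: es) (j + 1) = expAt es j := rfl
/-- `dec j [] = []`. [folklore] -/
@[simp] private theorem dec_nil (j : ℕ) : dec j [] = [] := by cases j <;> rfl
/-- `dec` at the head. [folklore] -/
@[simp] private theorem dec_cons_zero (e : ℕ) (es : Monomial) : dec 0 (e :: es) = (e - 1) :: es := rfl
/-- `dec` in the tail. [folklore] -/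
@[simp] private theorem dec_cons_succ (e : ℕ) (es : Monomial) (j : ℕ) :
    dec (j + 1) (e :: es) = e :: dec j es := rfl

end Monomial

/-! ### Partial and Lie derivatives (computable) -/

namespace Poly

/-- Partial derivative `∂p/∂x_k` of a sparse polynomial: each term `c·x^m` with `m_k ≠ 0`
becomes `(c·m_k)·x^(m − e_k)`; terms with `m_k = 0` are dropped. [folklore] -/
def pderiv (k : ℕ) (p : Poly) : Poly :=
  p.filterMap fun t =>
    if Monomial.expAt t.1 k = 0 then none else some (Monomial.dec k t.1, t.2 * (Monomial.expAt t.1 k : ℚ))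

/-- A bound on the variable indices of `p`: the maximal exponent-vector length. [folklore] -/
def numVars : Poly → ℕ
  | [] => 0
  | (m, _) :: p => max m.length (numVars p)

/-- Every term's exponent vector is no longer than `numVars`. [folklore] -/
private theorem length_le_numVars : ∀ (p : Poly) (t : Monomial × ℚ), t ∈ p → t.1.length ≤ numVars p
  | [], _, h => by simp at h
  | (m, c) :: p, t, h => by
      rcases List.mem_cons.1 h with rfl | h
      · exact le_max_left _ _
      · exact (length_le_numVars p t h).trans (le_max_right _ _)

/-- **Lie derivative** of `V` along the polynomial vector field `F` (component `k` of the field is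
`F[k]`, read as `0` when absent): `Σ_{k < numVars V} (∂_k V)·F_k`, as a concatenation of products
(concatenation of term lists = sum), normalised by `Poly.norm` — the polynomial `V̇(x) = (∂V/∂x | f(x))` of
Rouche–Habets–Laloy. [cite: RoucheHabetsLaloy1977, Ch. I §3.1 eq. (3.1)] -/
def lieDeriv (F : List Poly) (V : Poly) : Poly :=
  norm ((List.range (numVars V)).flatMap fun k => mul (pderiv k V) (F.getD k []))

/-! ### Semantics -/

section Semantics

variable {R : Type*} [Field R] [CharZero R]

/-- `eval` of the partial derivative, term by term (dropped terms contribute `0`). [folklore] -/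
private theorem eval_pderiv (x : ℕ → R) (k : ℕ) : ∀ p : Poly, eval x (pderiv k p) =
    (p.map fun t => (t.2 : R) * (Monomial.expAt t.1 k : R) * Monomial.eval x (Monomial.dec k t.1)).sum
  | [] => by simp [pderiv]
  | (m, c) :: p => by
      have ih := eval_pderiv x k p
      simp only [pderiv] at ih
      simp only [pderiv, List.filterMap_cons, List.map_cons, List.sum_cons]
      split_ifs with h
      · simp [ih, h]
      · rw [eval_cons, ih, Rat.cast_mul, Rat.cast_natCast]

omit [CharZero R] in
/-- A `Finset.range` sum is the sum over `List.range`. [folklore] -/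
private theorem sum_range_eq_list_sum {M : Type*} [AddCommMonoid M] (f : ℕ → M) :
    ∀ N : ℕ, ∑ k ∈ range N, f k = ((List.range N).map f).sum
  | 0 => by simp
  | N + 1 => by rw [sum_range_succ, sum_range_eq_list_sum f N, List.range_succ]; simp

/-- `eval` of the Lie derivative: `Σ_{k < numVars V} (∂_k V)(x) · F_k(x)` = `(∂V/∂x | F)(x)`.
[cite: RoucheHabetsLaloy1977, Ch. I §3.1 eq. (3.1)] -/
theorem eval_lieDeriv (x : ℕ → R) (F : List Poly) (V : Poly) :
    eval x (lieDeriv F V) = ∑ k ∈ range (numVars V), eval x (pderiv k V) * eval x (F.getD k []) := by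
  rw [lieDeriv, eval_norm, eval_flatMap, sum_range_eq_list_sum]
  simp [eval_mul]

end Semantics

/-! ### The chain rule along curves -/

section ChainRule

open Monomial

variable {z : ℝ → ℕ → ℝ} {g : ℕ → ℝ} {s : Set ℝ} {t : ℝ}

/-- **Product rule for a monomial along a curve.** If every coordinate `τ ↦ z τ k` has derivative
`g k` within `s` at `t`, then `τ ↦ evalFrom (z τ) k₀ m = ∏_j (z τ (k₀+j))^{m_j}` has derivative
`Σ_j m_j · g (k₀+j) · evalFrom (z t) k₀ (dec j m)`. [folklore] -/
private theorem hasDerivWithinAt_evalFrom (hz : ∀ k, HasDerivWithinAt (fun τ => z τ k) (g k) s t) :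
    ∀ (m : Monomial) (k₀ : ℕ), HasDerivWithinAt (fun τ => evalFrom (z τ) k₀ m)
      (∑ j ∈ range m.length, (expAt m j : ℝ) * g (k₀ + j) * evalFrom (z t) k₀ (dec j m)) s t
  | [], k₀ => by simpa using hasDerivWithinAt_const t s (1 : ℝ)
  | e :: es, k₀ => by
      have h1 : HasDerivWithinAt (fun τ => z τ k₀ ^ e) ((e : ℝ) * z t k₀ ^ (e - 1) * g k₀) s t :=
        (hz k₀).pow e
      have h2 := hasDerivWithinAt_evalFrom hz es (k₀ + 1)
      have h := h1.mul h2
      simp only [evalFrom_cons]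
      refine h.congr_deriv ?_
      rw [List.length_cons, sum_range_succ', add_comm, Finset.mul_sum]
      congr 1
      · refine sum_congr rfl fun j _ => ?_
        simp only [expAt_cons_succ, dec_cons_succ, evalFrom_cons]
        rw [Nat.add_comm j 1, ← Nat.add_assoc]
        ring
      · simp only [expAt_cons_zero, dec_cons_zero, evalFrom_cons, Nat.add_zero]
        ring

/-- The derivative of `τ ↦ p.eval (z τ)` produced by the chain rule, term by term:
`Σ_{(m,c) ∈ p} c · Σ_j m_j · g j · (x^{m − e_j})`. [folklore] -/
noncomputable def derivAlong (g : ℕ → ℝ) (x : ℕ → ℝ) : Poly → ℝ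
  | [] => 0
  | (m, c) :: p =>
      (c : ℝ) * (∑ j ∈ range m.length, (expAt m j : ℝ) * g j * evalFrom x 0 (dec j m)) +
        derivAlong g x p

/-- **Chain rule for a sparse polynomial along a curve** with arbitrary coordinate derivatives
`g k` (`V*(t) = V(x(t))` is differentiable with derivative `(∂V/∂x | ẋ)`). [cite: RoucheHabetsLaloy1977, Ch. I §3.1 eq. (3.1)] -/
theorem hasDerivWithinAt_eval (hz : ∀ k, HasDerivWithinAt (fun τ => z τ k) (g k) s t) :
    ∀ p : Poly, HasDerivWithinAt (fun τ => eval (z τ) p) (derivAlong g (z t) p) s t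
  | [] => by simpa [derivAlong] using hasDerivWithinAt_const t s (0 : ℝ)
  | (m, c) :: p => by
      have hm := hasDerivWithinAt_evalFrom hz m 0
      simp only [Nat.zero_add] at hm
      exact (hm.const_mul (c : ℝ)).add (hasDerivWithinAt_eval hz p)

/-- For one term, the chain-rule sum over `j < |m|` equals the sum over `j < N` for any
`N ≥ |m|` (exponents vanish beyond the vector). [folklore] -/
private theorem sum_range_length_eq (g : ℕ → ℝ) (x : ℕ → ℝ) (m : Monomial) {N : ℕ} (hN : m.length ≤ N) :
    ∑ j ∈ range m.length, (expAt m j : ℝ) * g j * evalFrom x 0 (dec j m) =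
      ∑ j ∈ range N, (expAt m j : ℝ) * g j * evalFrom x 0 (dec j m) := by
  refine sum_subset (range_subset_range.2 hN) fun j _ hj => ?_
  have hj' : m.length ≤ j := by simpa using hj
  simp [expAt_eq_zero_of_le m j hj']

/-- A finite sum of list sums is the list sum of the finite sums. [folklore] -/
private theorem sum_list_map_comm {ι α : Type*} (S : Finset ι) (f : ι → α → ℝ) :
    ∀ l : List α, ∑ k ∈ S, (l.map (f k)).sum = (l.map fun a => ∑ k ∈ S, f k a).sum
  | [] => by simp
  | a :: l => by simp [sum_add_distrib, sum_list_map_comm S f l]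

/-- `derivAlong` with coordinate derivatives `g` is the `eval` of the Lie derivative whenever
`g k = F_k(x)` for all `k`. [folklore] -/
private theorem derivAlong_eq_eval_lieDeriv (F : List Poly) (x : ℕ → ℝ) {g : ℕ → ℝ}
    (hg : ∀ k, g k = eval x (F.getD k [])) (V : Poly) :
    derivAlong g x V = eval x (lieDeriv F V) := by
  rw [eval_lieDeriv]
  -- rewrite every term's sum over `range (numVars V)`
  have key : ∀ p : Poly, (∀ t ∈ p, t.1.length ≤ numVars V) →
      derivAlong g x p = ∑ k ∈ range (numVars V), eval x (pderiv k p) * eval x (F.getD k []) := by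
    intro p hp
    induction p with
    | nil => simp [derivAlong, pderiv]
    | cons t p ih =>
        rcases t with ⟨m, c⟩
        have hm : m.length ≤ numVars V := hp (m, c) (by simp)
        have hp' : ∀ t ∈ p, t.1.length ≤ numVars V := fun t ht => hp t (by simp [ht])
        rw [derivAlong, ih hp', sum_range_length_eq g x m hm, mul_sum, ← sum_add_distrib]
        refine sum_congr rfl fun k _ => ?_
        rw [eval_pderiv, eval_pderiv, List.map_cons, List.sum_cons, hg k, Monomial.eval_eq]
        ring
  exact key V fun t ht => length_le_numVars V t ht

/-- **Chain rule with the Lie derivative.** If the curve `z` satisfies `d z_k/dt = F_k(z(t))`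
within `s` at `t` for every variable index `k` (components of `F` beyond its length read `0`),
then `d/dt V(z(t)) = (lieDeriv F V)(z(t))` within `s` at `t`. This is the hypothesis shape the
sublevel-set invariance theorems consume, with `V̇ := lieDeriv F V` computed in the kernel —
Rouche–Habets–Laloy's `V̇*(t) = V̇(t, x(t))`. [cite: RoucheHabetsLaloy1977, Ch. I §3.1 eq. (3.1)] -/
theorem hasDerivWithinAt_eval_lieDeriv {F : List Poly} (V : Poly)
    (hz : ∀ k, HasDerivWithinAt (fun τ => z τ k) (eval (z t) (F.getD k [])) s t) :
    HasDerivWithinAt (fun τ => eval (z τ) V) (eval (z t) (lieDeriv F V)) s t := by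
  rw [← derivAlong_eq_eval_lieDeriv F (z t) (fun k => rfl) V]
  exact hasDerivWithinAt_eval hz V

/-- `HasDerivAt` form of the chain rule. [cite: RoucheHabetsLaloy1977, Ch. I §3.1 eq. (3.1)] -/
theorem hasDerivAt_eval_lieDeriv {F : List Poly} (V : Poly)
    (hz : ∀ k, HasDerivAt (fun τ => z τ k) (eval (z t) (F.getD k [])) t) :
    HasDerivAt (fun τ => eval (z τ) V) (eval (z t) (lieDeriv F V)) t := by
  exact hasDerivWithinAt_univ.mp
    (hasDerivWithinAt_eval_lieDeriv V fun k => (hz k).hasDerivWithinAt)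

end ChainRule

/-! ### Tests -/

section Tests

/-- Test: `∂/∂x₀ (3 x₀² x₁ + x₁) = 6 x₀ x₁` (after `norm`), `∂/∂x₁ = 3 x₀² + 1`. -/
example : norm (pderiv 0 [(([2, 1] : List ℕ), (3 : ℚ)), (([0, 1] : List ℕ), (1 : ℚ))]) =
    [(([1, 1] : List ℕ), (6 : ℚ))] ∧
    norm (pderiv 1 [(([2, 1] : List ℕ), (3 : ℚ)), (([0, 1] : List ℕ), (1 : ℚ))]) =
    [(([] : List ℕ), (1 : ℚ)), (([2] : List ℕ), (3 : ℚ))] := by decide +kernel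

/-- Test (harmonic oscillator): along `F = (x₁, −x₀)` the Lie derivative of `V = x₀² + x₁²` is
the zero polynomial. -/
example : lieDeriv [[(([0, 1] : List ℕ), (1 : ℚ))], [(([1] : List ℕ), (-1 : ℚ))]]
    [(([2] : List ℕ), (1 : ℚ)), (([0, 2] : List ℕ), (1 : ℚ))] = [] := by decide +kernel

/-- Test (damped oscillator `ẋ₀ = x₁`, `ẋ₁ = −x₀ − x₁`): `lieDeriv F (x₀² + x₁²) = −2 x₁²`. -/
example : lieDeriv [[(([0, 1] : List ℕ), (1 : ℚ))], [(([1] : List ℕ), (-1 : ℚ)), (([0, 1] : List ℕ), (-1 : ℚ))]]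
    [(([2] : List ℕ), (1 : ℚ)), (([0, 2] : List ℕ), (1 : ℚ))] = [(([0, 2] : List ℕ), (-2 : ℚ))] := by
  decide +kernel

end Tests

end Poly

end SOS

end Literature.Computation.Certificates
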